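import Literature.Computability.Cryptography.ChenQuantumLWECountingLaw

/-!
# Eq. (41) of Chen's Step 9 carries at most `1/Q` of the weight — the typed claim versus the counting law

REPRODUCTION / ANALYSIS OF A CLAIMED RESULT UNDER ADJUDICATION (withdrawn): Yilei Chen, *Quantum
Algorithms for Lattice Problems*, IACR ePrint 2024/555, version of 2024-04-18 [ChenQuantumLattice2024],
Step 9 (§3.5.9, pp. 34–38): Lemma 3.8 and eq. (41) p. 38, `u₁ + ⟨b*[2..n], u[2..n]⟩ ≡ 0 (mod p₁p′)`,
claimed to hold WITH CERTAINTY; the author's withdrawal note is quoted in `ChenQuantumLWESteps.lean`.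
Bundle `papers/QuantumAdvantage/lwe-quantum-autopsy/`, Part 2 (`REPAIR-CENSUS.md` T2 / §8), a corollary
of Part 1's output law (`ChenQuantumLWEOutputLaw.lean`, `Shape.outputWeight_eq`) and counting law
(`ChenQuantumLWECountingLaw.lean`, `Shape.eq41_modQ_fraction`).  HONEST FRAMING: a kernel-checked
THEOREM about the measurement statistics of a WITHDRAWN algorithm — a precise negative result, NOT
summit progress, no cryptanalytic claim.

Content.  `ChenQuantumLWESteps.lean` types eq. (41) as `Shape.eq41 u` (a congruence modulo `P = p₁Q` on
the full outcome `u = (u₀ | u′)`) and Lemma 3.8's certainty claim as `Shape.Lemma38Certainty`.  Part 1's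
`Shape.eq41_modQ_fraction` says that for every kernel on coordinate `0`, every coordinate-`0` outcome and
every residue `γ ∈ ℤ_Q`, the `u′` with `⟨b*[1..n], u′⟩ ≡ γ (mod Q)` carry exactly `1/Q` of the weight.
Here the two are joined:
* `Shape.tailResidue_eq_of_eq41` — eq. (41) for `(u₀ | u′)` forces `⟨b*[1..n], u′⟩ ≡ -u₀ (mod Q)`
  (reduce the typed congruence from `ℤ_P` to `ℤ_Q`, `Q ∣ P`);
* `Shape.eq41_weight_le` — hence, under the Bezout hypothesis of the counting law, for every admissible
  shape, every kernel `K` on coordinate `0`, every coordinate-`0` outcome `x′` and every value `u₀` read in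
  register `0`: `(Σ_{u′ : eq41 (u₀|u′)} weight(x′,u′)) · Q ≤ Σ_{u′} weight(x′,u′)` — the outcomes
  satisfying eq. (41) carry AT MOST `1/Q ≤ 1/3` of the weight, for every conceivable processing of
  coordinate `0`, against the claimed probability `1`.
(`Shape.eq41` is used through a `[DecidablePred S.eq41]` binder — any instance, e.g.
`fun _ => by unfold Shape.eq41; infer_instance`.)  Not here: the `mod p₁` part of (41) (which Chen's
own (9.e)–(9.h) satisfy trivially, `STEPS.md` §4.4(d)), normalisation of states.
-/

namespace Literature.Computability.Cryptography.Chen2024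

open scoped BigOperators

namespace Shape

variable (S : Shape)

/-- `Q ∣ P = p₁Q`. [cite: ChenQuantumLattice2024, Cond. C.3 p. 18] -/
theorem Q_dvd_P : (S.Q : ℕ) ∣ S.P :=
  ⟨(S.p₁ : ℕ), by simp only [Shape.P, PNat.mul_coe]; ring⟩

/-- Eq. (41) for the outcome `(u₀ | u′)` implies `⟨b*[1..n], u′⟩ ≡ -u₀ (mod Q)`: the typed congruence
modulo `P = p₁Q` reduced modulo `Q`. [cite: ChenQuantumLattice2024, eq. (41) p. 38] -/
theorem tailResidue_eq_of_eq41 (u₀ : ZMod S.N) (u' : Fin S.n → ZMod S.N)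
    (h41 : S.eq41 (Fin.cons u₀ u')) :
    S.tailResidue u' = -(((u₀.val : ℕ)) : ZMod S.Q) := by
  unfold eq41 at h41
  have h := congrArg (ZMod.castHom S.Q_dvd_P (ZMod S.Q)) h41
  rw [map_intCast, map_zero] at h
  simp only [Fin.cons_zero, Fin.cons_succ, Int.cast_add, Int.cast_sum, Int.cast_mul,
    Int.cast_natCast] at h
  exact eq_neg_of_add_eq_zero_right h

/-- **Eq. (41) carries at most `1/Q` of the weight.**  For every admissible shape with the Bezout
hypothesis of `ChenQuantumLWECountingLaw` on `b*[1..n] mod Q` (true for Chen's `b*` by eq. (39)), every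
kernel `K` on coordinate `0` of `|φ8.f⟩` (absorbing (9.e)–(9.g), any replacement of them, and the
coordinate-`0` factor of the final `QFT`, cf. `splitFirst_qft`; in Chen's run `x′ = u₀`), every
coordinate-`0` outcome `x′` and every `u₀`: the outcomes `u′ ∈ ℤ_Nⁿ` for which eq. (41) holds at `(u₀ | u′)`
carry at most `1/Q` of the total weight at `x′` — against Lemma 3.8's probability `1` (`Q ≥ 3`).
[cite: ChenQuantumLattice2024, Lemma 3.8 and eq. (41) p. 38] -/
theorem eq41_weight_le (h : S.Admissible) [DecidablePred S.eq41] {α' : Type*}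
    (K : α' → ZMod S.N → ℂ) (x' : α')
    (w : Fin S.n → ℤ) (hw : ((∑ t, w t * S.bstar (Fin.succ t) : ℤ) : ZMod S.Q) = 1) (u₀ : ZMod S.N) :
    (∑ u' ∈ Finset.univ.filter (fun u' : Fin S.n → ZMod S.N => S.eq41 (Fin.cons u₀ u')),
        ‖qftTail (fun z : α' × (Fin S.n → ZMod S.N) => ∑ x, K z.1 x * splitFirst S.phi8f (x, z.2))
            (x', u')‖ ^ 2) * S.Q
      ≤ ∑ u' : Fin S.n → ZMod S.N,
        ‖qftTail (fun z : α' × (Fin S.n → ZMod S.N) => ∑ x, K z.1 x * splitFirst S.phi8f (x, z.2))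
            (x', u')‖ ^ 2 := by
  rw [← S.eq41_modQ_fraction h K x' w hw (-(((u₀.val : ℕ)) : ZMod S.Q))]
  refine mul_le_mul_of_nonneg_right ?_ (by positivity)
  refine Finset.sum_le_sum_of_subset_of_nonneg (fun u' hu' => ?_) (fun _ _ _ => by positivity)
  rw [Finset.mem_filter] at hu' ⊢
  exact ⟨hu'.1, S.tailResidue_eq_of_eq41 u₀ u' hu'.2⟩

/-- Strict form: wherever the total weight at a coordinate-`0` outcome `x′` is positive, the eq.-(41)
outcomes carry STRICTLY less than all of it (indeed at most a third, `Q ≥ 3`) — so some outcome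
`(u₀ | u′)` of positive weight violates eq. (41): Lemma 3.8's certainty fails fibrewise for every kernel.
[cite: ChenQuantumLattice2024, Lemma 3.8 p. 38] -/
theorem eq41_weight_lt (h : S.Admissible) [DecidablePred S.eq41] {α' : Type*}
    (K : α' → ZMod S.N → ℂ) (x' : α')
    (w : Fin S.n → ℤ) (hw : ((∑ t, w t * S.bstar (Fin.succ t) : ℤ) : ZMod S.Q) = 1) (u₀ : ZMod S.N)
    (hpos : 0 < ∑ u' : Fin S.n → ZMod S.N,
        ‖qftTail (fun z : α' × (Fin S.n → ZMod S.N) => ∑ x, K z.1 x * splitFirst S.phi8f (x, z.2))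
            (x', u')‖ ^ 2) :
    (∑ u' ∈ Finset.univ.filter (fun u' : Fin S.n → ZMod S.N => S.eq41 (Fin.cons u₀ u')),
        ‖qftTail (fun z : α' × (Fin S.n → ZMod S.N) => ∑ x, K z.1 x * splitFirst S.phi8f (x, z.2))
            (x', u')‖ ^ 2)
      < ∑ u' : Fin S.n → ZMod S.N,
        ‖qftTail (fun z : α' × (Fin S.n → ZMod S.N) => ∑ x, K z.1 x * splitFirst S.phi8f (x, z.2))
            (x', u')‖ ^ 2 := by
  have hle := S.eq41_weight_le h K x' w hw u₀
  have hQ : (3 : ℝ) ≤ S.Q := by exact_mod_cast h.three_le_Q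
  set A := ∑ u' ∈ Finset.univ.filter (fun u' : Fin S.n → ZMod S.N => S.eq41 (Fin.cons u₀ u')),
        ‖qftTail (fun z : α' × (Fin S.n → ZMod S.N) => ∑ x, K z.1 x * splitFirst S.phi8f (x, z.2))
            (x', u')‖ ^ 2 with hA
  set T := ∑ u' : Fin S.n → ZMod S.N,
        ‖qftTail (fun z : α' × (Fin S.n → ZMod S.N) => ∑ x, K z.1 x * splitFirst S.phi8f (x, z.2))
            (x', u')‖ ^ 2 with hT
  have hA0 : 0 ≤ A := by rw [hA]; positivity
  nlinarith

end Shape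

end Literature.Computability.Cryptography.Chen2024
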